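import Summits.BirchSwinnertonDyer.BirchSwinnertonDyer.Theorems.KatoDescentPotSupersingularKatoFiniteLevelStrictTamagawa
import Summits.BirchSwinnertonDyer.BirchSwinnertonDyer.Theorems.KatoDescentPotSupersingularKummerImagePrimaryCount
import Summits.BirchSwinnertonDyer.Rank1Residual.X11b.LevelLiftingLower
import Summits.BirchSwinnertonDyer.Rank1Residual.X11b.RouteR1Coinvariants
import HarnessLib

/-!
# Kato's group `S(E[p^∞])` (Kummer at `P ⊇ {v ∣ p}`, UNRAMIFIED at the finite `v ∉ P`) is FINITE when `Sel_{p^∞}(E/K)` is, with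
# `#S ≤ #Sel_{p^∞}(E/K) · ∏_{v ∈ T∖P} #H¹_ur(K_v, E[p^∞])`; its exponent `p^m` and the local torsion exponent `p^j` exist
# (route `KatoDescentPotSupersingular` / `…Tame…`, crux M = stmt-BirchSwinnertonDyer-19196; route-free helper)

Seat `bsd-potss-rkm` g19 (prover; cell `bsd-potss`), item stmt-BirchSwinnertonDyer-19196 (`--supports … --as helper`; closes
nothing).  HONEST FRAMING: BSD is not proved by any of this; nothing is booked; theorems only (no definition, no named fact).

## What (Kato, Astérisque 295, §14.8 p. 238: "`Sel(K,T) ⊂ S(K,T)` and `S(K,T)/Sel(K,T)` is a finite group which is embedded into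
## `⊕_{v∤p} H¹(K_v, T⊗ℚ/ℤ)/Image(H¹_f)`"; the S-side twin of seat g17's part 11 `…KatoFiniteLevelStrictTamagawa` for the STRICT group)

`S = H¹_{𝓤∞}(K, E[p^∞]) ⊓ 𝓚_P` with `𝓤∞` a Selmer structure `⊤` at the places of `P`, UNRAMIFIED at the finite `v ∉ P`, `⊤` at `∞`, and
`𝓚_P ≤ H¹(K, E[p^∞])` ANY subgroup whose classes satisfy the `p^∞` Kummer condition (`selmerLocalKerPrimary`, "dies in `H¹(K_v, E)`") at every
`v ∈ P` (over `ℚ`: `𝓚_P = selmerLocalKerPrimary W ℚ_p p`, the spelling of parts 36–37); `T ⊇ P` finite, containing the bad places and the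
places above `p`; `p` odd.

* `mem_selmerGroupPInfty_of_kato_of_localization_eq_zero` — a class of `S` locally trivial at the places of `T ∖ P` lies in `Sel_{p^∞}(E/K)`
  (Kummer at `P` by `𝓚_P`; zero on `T ∖ P`; `H¹_ur(K_v,E[p^∞]) = 0` at the good `v ∉ T`, X11b; `∞` for odd `p`, g17).
* **`natCard_kato_le_selmerGroupPInfty_mul_prod`**: **`#S ≤ #Sel_{p^∞}(E/K) · ∏_{v∈T∖P} #H¹_ur(K_v, E[p^∞])`** and **`finite_kato`**: `S` is
  finite whenever `Sel_{p^∞}(E/K)` is (the localisation `S → ∏_{v∈T∖P} H¹_ur(K_v,E[p^∞])` has finite target — `H¹(K_v,E[p^∞])` finite for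
  `v ∤ p` — and kernel inside `Sel_{p^∞}`); `exists_pow_nsmul_kato_eq_zero`: hence `p^m · S = 0` for some `m` (hypothesis `hm` of part 37);
  over `ℚ`: `natCard_kato_le_selmerGroupPInfty_mul_prod_rat`, `finite_kato_rat`, `exists_pow_nsmul_kato_eq_zero_rat`.
* `exists_pow_nsmul_eq_zero_of_primary_localPoints` — **`p^j` kills the `p`-power torsion of `E(K_v)`** for some `j` (the torsion of `E(K_v)` is
  finite, part 33 `finite_torsion_baseChange_adicCompletion`) — hypothesis `hj` of parts 35/37.

In rank `0` (`Sel_{p^∞} = Ш[p^∞]` finite) the displayed bound is the TRIVIAL direction `#S ≤ #Ш[p^∞]·∏ c_v^{(p)}` (with g18's Néron reading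
`#H¹_ur(K_v,E[p^∞]) = p^{v_p(c_v)}`); the direction crux M consumes, `#Ш[p^∞]·∏ c_v^{(p)} ≤ #S·p^{t₀}`, is the Poitou–Tate cokernel statement (ii)
of memo `HOME/rkm/FINDING-19196-rkm-g18.md`, NOT proved here.

References: K. Kato, Astérisque 295 (2004) §14.8 (p. 238) [Kato2004Asterisque]; R. Greenberg, LNM 1716 §3 Lemma 3.3, §5 Prop. 5.8 [GreenbergLNM1716];
J. S. Milne, *ADT* I Lemma 3.3, Cor. 2.3 [MilneADT2006]; J. H. Silverman, *AEC* VII.6.3 [SilvermanAEC2009].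
-/

-- the summit and its single problem are both named `BirchSwinnertonDyer` (registry layout D-0017)
set_option linter.dupNamespace false
set_option autoImplicit false

noncomputable section

open scoped Classical ContRepresentation NumberField
open Function Field NumberField IsDedekindDomain WeierstrassCurve
open Literature.NumberTheory.EllipticCurves Literature.NumberTheory.GaloisRepresentations
  Literature.NumberTheory.GaloisRepresentations.DiscreteGaloisModule Literature.NumberTheory.GaloisCohomology
open Literature.NumberTheory.EllipticCurves.Kato2004
open Summit.BirchSwinnertonDyer.Rank1Residual.X11b.LocBridge

namespace Summit.BirchSwinnertonDyer.BirchSwinnertonDyer.Theorems.KatoFiniteLevelCount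

/-! ## §1 `S ⊓ ker(loc_{T∖P}) ≤ Sel_{p^∞}(E/K)` and `#S ≤ #Sel_{p^∞} · ∏_{v∈T∖P} #H¹_ur` -/

section Kato

variable {K : Type} [Field K] [NumberField K] (W : WeierstrassCurve K) [W.IsElliptic] (p : ℕ) [Fact p.Prime]

/-- **A class of Kato's `S` which is locally trivial at the places of `T ∖ P` lies in `Sel_{p^∞}(E/K)`** (`p` odd): at `v ∈ P` it satisfies the
`p^∞` Kummer condition by `𝓚_P`; at `v ∈ T ∖ P` and at the good `v ∉ T` (where `H¹_ur(K_v, E[p^∞]) = 0`, X11b) it is locally ZERO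
(g17 `mem_selmerLocalKerPrimary_of_localization_eq_zero`); at `∞`, `p` is odd (g17 `mem_selmerLocalKerPrimary_infinitePlace_of_odd`).
[cite: Kato2004Asterisque, §14.8 (p. 238)] [cite: GreenbergLNM1716, §3 Lemma 3.3] -/
theorem mem_selmerGroupPInfty_of_kato_of_localization_eq_zero (hodd : p ≠ 2) (P T : Finset (HeightOneSpectrum (𝓞 K)))
    (hT : ∀ v : HeightOneSpectrum (𝓞 K), v ∉ T → (p : 𝓞 K) ∉ v.asIdeal ∧ W.HasGoodReductionAt v)
    (𝓤inf : SelmerStructure (primaryGaloisModule W p))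
    (hUur : ∀ v ∉ P, 𝓤inf (Sum.inr v) = unramifiedSubgroup (GaloisRep.toLocal v (primaryGaloisModule W p)) 1)
    (𝓚P : AddSubgroup (galoisCohomology (primaryGaloisModule W p) 1))
    (h𝓚P : ∀ c ∈ 𝓚P, ∀ v ∈ P, c ∈ selmerLocalKerPrimary W (v.adicCompletion K) p)
    {c : galoisCohomology (primaryGaloisModule W p) 1} (hc : c ∈ 𝓤inf.selmerGroup ⊓ 𝓚P)
    (hcT : ∀ v ∈ T, v ∉ P → galoisCohomology.localization (primaryGaloisModule W p) (Sum.inr v) 1 c = 0) :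
    c ∈ W.selmerGroupPInfty p := by
  have hcU := (SelmerStructure.mem_selmerGroup_iff _ _).mp hc.1
  refine AddSubgroup.mem_inf.mpr ⟨AddSubgroup.mem_iInf.mpr fun v => ?_,
    AddSubgroup.mem_iInf.mpr fun w => mem_selmerLocalKerPrimary_infinitePlace_of_odd W p hodd w c⟩
  by_cases hvP : v ∈ P
  · exact h𝓚P c hc.2 v hvP
  · refine mem_selmerLocalKerPrimary_of_localization_eq_zero W p (v.adicCompletion K) c ?_
    by_cases hvT : v ∈ T
    · exact hcT v hvT hvP
    · -- good place outside `T`: `H¹_ur = 0`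
      have h := hcU (Sum.inr v)
      rw [hUur v hvP] at h
      have h' : galoisCohomology.localization (primaryGaloisModule W p) (Sum.inr v) 1 c ∈
          unramifiedSubgroup (GaloisRep.restrictField (v.adicCompletion K) (primaryGaloisModule W p)) 1 := h
      rw [unramifiedSubgroup_primary_eq_bot W p (hT v hvT).1 (hT v hvT).2] at h'
      exact (AddSubgroup.mem_bot).mp h'

/-- **`#S ≤ #Sel_{p^∞}(E/K) · ∏_{v ∈ T∖P} #H¹_ur(K_v, E[p^∞])` and `S` is finite** (Kato §14.8: `S/Sel` embeds into `⊕_{v∤p} H¹_ur`), for Kato's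
`S = H¹_{𝓤∞} ⊓ 𝓚_P` (`𝓤∞` unramified at the finite `v ∉ P`, anything at `P` and `∞`; `𝓚_P` = Kummer at `P`), `Sel_{p^∞}(E/K)` finite, `p` odd,
`T ⊇ P` containing the bad places and those above `p`: the localisation `S → ∏_{v∈T∖P} H¹_ur(K_v,E[p^∞])` has finite target (`v ∤ p`, X11b
`finite_galoisCohomology_one_primary_toLocal`, Tate's local Euler characteristic a tree theorem) and kernel in `Sel_{p^∞}` (§1).
[cite: Kato2004Asterisque, §14.8 (p. 238)] [cite: GreenbergLNM1716, §3 Lemma 3.3] -/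
theorem finite_kato_and_natCard_le (hodd : p ≠ 2) (P T : Finset (HeightOneSpectrum (𝓞 K)))
    (hT : ∀ v : HeightOneSpectrum (𝓞 K), v ∉ T → (p : 𝓞 K) ∉ v.asIdeal ∧ W.HasGoodReductionAt v)
    (hPp : ∀ v : HeightOneSpectrum (𝓞 K), (p : 𝓞 K) ∈ v.asIdeal → v ∈ P)
    (𝓤inf : SelmerStructure (primaryGaloisModule W p)) [Finite (W.selmerGroupPInfty p)]
    (hUur : ∀ v ∉ P, 𝓤inf (Sum.inr v) = unramifiedSubgroup (GaloisRep.toLocal v (primaryGaloisModule W p)) 1)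
    (𝓚P : AddSubgroup (galoisCohomology (primaryGaloisModule W p) 1))
    (h𝓚P : ∀ c ∈ 𝓚P, ∀ v ∈ P, c ∈ selmerLocalKerPrimary W (v.adicCompletion K) p) :
    Finite ↥(𝓤inf.selmerGroup ⊓ 𝓚P) ∧
      Nat.card ↥(𝓤inf.selmerGroup ⊓ 𝓚P) ≤
        Nat.card (W.selmerGroupPInfty p) *
          ∏ v ∈ T \ P, Nat.card (unramifiedSubgroup (GaloisRep.toLocal v (primaryGaloisModule W p)) 1) := by
  classical
  set S := 𝓤inf.selmerGroup ⊓ 𝓚P with hS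
  -- index set `T ∖ P` and the finite local targets
  let ι : Type := {v // v ∈ T \ P}
  have hι : ∀ v : ι, (v.1 ∈ T) ∧ v.1 ∉ P := fun v => Finset.mem_sdiff.1 v.2
  haveI hfinloc : ∀ v : ι, Finite (galoisCohomology (GaloisRep.toLocal v.1 (primaryGaloisModule W p)) 1) := by
    intro v
    haveI : CharZero (v.1.adicCompletion K) := charZero_adicCompletion _
    exact finite_galoisCohomology_one_primary_toLocal W p v.1 (localEulerPoincareCharacteristic_holds _)
      (fun h => (hι v).2 (hPp _ h))
  -- the localisation lands in the unramified subgroups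
  have hmem : ∀ (c : S) (v : ι),
      galoisCohomology.localization (primaryGaloisModule W p) (Sum.inr v.1) 1
          (c : galoisCohomology (primaryGaloisModule W p) 1) ∈
        unramifiedSubgroup (GaloisRep.toLocal v.1 (primaryGaloisModule W p)) 1 := by
    intro c v
    have h := (SelmerStructure.mem_selmerGroup_iff _ _).mp c.2.1 (Sum.inr v.1)
    rw [hUur v.1 (hι v).2] at h
    exact h
  let g : ∀ v : ι, S →+ unramifiedSubgroup (GaloisRep.toLocal v.1 (primaryGaloisModule W p)) 1 := fun v =>
    { toFun := fun c => ⟨galoisCohomology.localization (primaryGaloisModule W p) (Sum.inr v.1) 1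
          (c : galoisCohomology (primaryGaloisModule W p) 1), hmem c v⟩
      map_zero' := Subtype.ext (map_zero _)
      map_add' := fun a b => Subtype.ext (map_add _ _ _) }
  let f := AddMonoidHom.pi g
  -- the kernel lies in `Sel_{p^∞}(E/K)`
  have hker : ∀ c : S, f c = 0 → (c : galoisCohomology (primaryGaloisModule W p) 1) ∈ W.selmerGroupPInfty p := by
    intro c hc
    exact mem_selmerGroupPInfty_of_kato_of_localization_eq_zero W p hodd P T hT 𝓤inf hUur 𝓚P h𝓚P c.2 fun v hvT hvP =>
      congrArg Subtype.val (congrFun hc ⟨v, Finset.mem_sdiff.2 ⟨hvT, hvP⟩⟩)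
  -- count: `#S = #ker · #range ≤ #Sel_{p^∞} · #(∏ H¹_ur)`
  haveI hkerfin : Finite f.ker :=
    Finite.of_injective (fun c : f.ker => (⟨((c : S) : galoisCohomology (primaryGaloisModule W p) 1),
      hker (c : S) ((AddMonoidHom.mem_ker).1 c.2)⟩ : W.selmerGroupPInfty p)) fun a b h => by
        apply Subtype.ext; apply Subtype.ext
        exact congrArg (fun x : W.selmerGroupPInfty p => (x : W.galH1Primary p)) h
  have hker_le : Nat.card f.ker ≤ Nat.card (W.selmerGroupPInfty p) :=
    Nat.card_le_card_of_injective
      (fun c : f.ker => (⟨((c : S) : galoisCohomology (primaryGaloisModule W p) 1),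
        hker (c : S) ((AddMonoidHom.mem_ker).1 c.2)⟩ : W.selmerGroupPInfty p)) fun a b h => by
        apply Subtype.ext; apply Subtype.ext
        exact congrArg (fun x : W.selmerGroupPInfty p => (x : W.galH1Primary p)) h
  haveI hrangefin : Finite f.range := by
    haveI : ∀ v : ι, Finite (unramifiedSubgroup (GaloisRep.toLocal v.1 (primaryGaloisModule W p)) 1) := fun v =>
      inferInstance
    exact Finite.of_injective _ f.range.subtype_injective
  have hrange_le : Nat.card f.range ≤
      ∏ v ∈ T \ P, Nat.card (unramifiedSubgroup (GaloisRep.toLocal v (primaryGaloisModule W p)) 1) := by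
    haveI : ∀ v : ι, Finite (unramifiedSubgroup (GaloisRep.toLocal v.1 (primaryGaloisModule W p)) 1) := fun v =>
      inferInstance
    rw [← Finset.prod_coe_sort, ← Nat.card_pi]
    exact Nat.card_le_card_of_injective _ f.range.subtype_injective
  have hcard : Nat.card S = Nat.card f.ker * Nat.card f.range := by
    rw [AddSubgroup.card_eq_card_quotient_mul_card_addSubgroup f.ker, mul_comm,
      Nat.card_congr (QuotientAddGroup.quotientKerEquivRange f).toEquiv]
  refine ⟨Nat.finite_of_card_ne_zero ?_, ?_⟩
  · rw [hcard]; exact mul_ne_zero Nat.card_pos.ne' Nat.card_pos.ne'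
  · rw [hcard]; exact Nat.mul_le_mul hker_le hrange_le

/-- **Kato's `S` is finite** when `Sel_{p^∞}(E/K)` is (`p` odd). [cite: Kato2004Asterisque, §14.8 (p. 238)] -/
theorem finite_kato (hodd : p ≠ 2) (P T : Finset (HeightOneSpectrum (𝓞 K)))
    (hT : ∀ v : HeightOneSpectrum (𝓞 K), v ∉ T → (p : 𝓞 K) ∉ v.asIdeal ∧ W.HasGoodReductionAt v)
    (hPp : ∀ v : HeightOneSpectrum (𝓞 K), (p : 𝓞 K) ∈ v.asIdeal → v ∈ P)
    (𝓤inf : SelmerStructure (primaryGaloisModule W p)) [Finite (W.selmerGroupPInfty p)]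
    (hUur : ∀ v ∉ P, 𝓤inf (Sum.inr v) = unramifiedSubgroup (GaloisRep.toLocal v (primaryGaloisModule W p)) 1)
    (𝓚P : AddSubgroup (galoisCohomology (primaryGaloisModule W p) 1))
    (h𝓚P : ∀ c ∈ 𝓚P, ∀ v ∈ P, c ∈ selmerLocalKerPrimary W (v.adicCompletion K) p) :
    Finite ↥(𝓤inf.selmerGroup ⊓ 𝓚P) :=
  (finite_kato_and_natCard_le W p hodd P T hT hPp 𝓤inf hUur 𝓚P h𝓚P).1

/-- **`#S ≤ #Sel_{p^∞}(E/K) · ∏_{v ∈ T∖P} #H¹_ur(K_v, E[p^∞])`** (Kato §14.8: `S/Sel ↪ ⊕_{v∤p} H¹_ur`). In rank `0` this is the trivial direction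
`#S ≤ #Ш[p^∞] · ∏ c_v^{(p)}`; crux M consumes the converse `#Ш[p^∞]·∏ c_v^{(p)} ≤ #S · p^{t₀}` (Poitou–Tate), not proved here.
[cite: Kato2004Asterisque, §14.8 (p. 238)] [cite: GreenbergLNM1716, §3 Lemma 3.3] -/
theorem natCard_kato_le_selmerGroupPInfty_mul_prod (hodd : p ≠ 2) (P T : Finset (HeightOneSpectrum (𝓞 K)))
    (hT : ∀ v : HeightOneSpectrum (𝓞 K), v ∉ T → (p : 𝓞 K) ∉ v.asIdeal ∧ W.HasGoodReductionAt v)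
    (hPp : ∀ v : HeightOneSpectrum (𝓞 K), (p : 𝓞 K) ∈ v.asIdeal → v ∈ P)
    (𝓤inf : SelmerStructure (primaryGaloisModule W p)) [Finite (W.selmerGroupPInfty p)]
    (hUur : ∀ v ∉ P, 𝓤inf (Sum.inr v) = unramifiedSubgroup (GaloisRep.toLocal v (primaryGaloisModule W p)) 1)
    (𝓚P : AddSubgroup (galoisCohomology (primaryGaloisModule W p) 1))
    (h𝓚P : ∀ c ∈ 𝓚P, ∀ v ∈ P, c ∈ selmerLocalKerPrimary W (v.adicCompletion K) p) :
    Nat.card ↥(𝓤inf.selmerGroup ⊓ 𝓚P) ≤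
      Nat.card (W.selmerGroupPInfty p) *
        ∏ v ∈ T \ P, Nat.card (unramifiedSubgroup (GaloisRep.toLocal v (primaryGaloisModule W p)) 1) :=
  (finite_kato_and_natCard_le W p hodd P T hT hPp 𝓤inf hUur 𝓚P h𝓚P).2

/-- **`p^m · S = 0` for some `m ≥ 1`** (`S` is a finite subgroup of the `p`-primary group `H¹(K, E[p^∞])`; X11b `exists_pow_nsmul_eq_zero_of_finite`)
— the hypothesis `hm` of brick (a). [cite: Kato2004Asterisque, §14.8 (p. 238)] -/
theorem exists_pow_nsmul_kato_eq_zero (hodd : p ≠ 2) (P T : Finset (HeightOneSpectrum (𝓞 K)))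
    (hT : ∀ v : HeightOneSpectrum (𝓞 K), v ∉ T → (p : 𝓞 K) ∉ v.asIdeal ∧ W.HasGoodReductionAt v)
    (hPp : ∀ v : HeightOneSpectrum (𝓞 K), (p : 𝓞 K) ∈ v.asIdeal → v ∈ P)
    (𝓤inf : SelmerStructure (primaryGaloisModule W p)) [Finite (W.selmerGroupPInfty p)]
    (hUur : ∀ v ∉ P, 𝓤inf (Sum.inr v) = unramifiedSubgroup (GaloisRep.toLocal v (primaryGaloisModule W p)) 1)
    (𝓚P : AddSubgroup (galoisCohomology (primaryGaloisModule W p) 1))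
    (h𝓚P : ∀ c ∈ 𝓚P, ∀ v ∈ P, c ∈ selmerLocalKerPrimary W (v.adicCompletion K) p) :
    ∃ m : ℕ, 1 ≤ m ∧ ∀ c ∈ 𝓤inf.selmerGroup ⊓ 𝓚P, p ^ m • c = 0 := by
  haveI := finite_kato W p hodd P T hT hPp 𝓤inf hUur 𝓚P h𝓚P
  exact Rank1Residual.X11b.AcSelmer.exists_pow_nsmul_eq_zero_of_finite _

end Kato

/-! ## §2 Over `ℚ` (`P = {v_p}`, `𝓚_P = selmerLocalKerPrimary W ℚ_p p`) -/

section Rat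

variable (W : WeierstrassCurve ℚ) [W.IsElliptic] (p : ℕ) [Fact p.Prime]

/-- **Over `ℚ`: `#S ≤ #Sel_{p^∞}(E/ℚ) · ∏_{ℓ ∈ T∖{p}} #H¹_ur(ℚ_ℓ, E[p^∞])`** for Kato's `S = H¹_{𝓤∞} ⊓ selmerLocalKerPrimary W ℚ_p p`, the spelling of
parts 36–37 (`𝓤∞` unramified at every `ℓ ≠ p`; `T ∋ v_p` containing the bad places; `p` odd). [cite: Kato2004Asterisque, §14.8 (p. 238)] -/
theorem natCard_kato_le_selmerGroupPInfty_mul_prod_rat (hodd : p ≠ 2) (T : Finset (HeightOneSpectrum (𝓞 ℚ)))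
    (hpT : primePlace p ∈ T) (hT : ∀ v : HeightOneSpectrum (𝓞 ℚ), v ∉ T → W.HasGoodReductionAt v)
    (𝓤inf : SelmerStructure (primaryGaloisModule W p)) [Finite (W.selmerGroupPInfty p)]
    (hUur : ∀ v : HeightOneSpectrum (𝓞 ℚ), v ≠ primePlace p →
      𝓤inf (Sum.inr v) = unramifiedSubgroup (GaloisRep.toLocal v (primaryGaloisModule W p)) 1) :
    Finite ↥(𝓤inf.selmerGroup ⊓ selmerLocalKerPrimary W ((primePlace p).adicCompletion ℚ) p) ∧
      Nat.card ↥(𝓤inf.selmerGroup ⊓ selmerLocalKerPrimary W ((primePlace p).adicCompletion ℚ) p) ≤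
        Nat.card (W.selmerGroupPInfty p) *
          ∏ v ∈ T \ {primePlace p}, Nat.card (unramifiedSubgroup (GaloisRep.toLocal v (primaryGaloisModule W p)) 1) := by
  have hmemP : ∀ v : HeightOneSpectrum (𝓞 ℚ), v ∈ ({primePlace p} : Finset _) ↔ v = primePlace p := fun v => Finset.mem_singleton
  exact finite_kato_and_natCard_le W p hodd {primePlace p} T
    (fun v hv => ⟨natCast_not_mem_of_ne_primePlace p (fun h => hv (h ▸ hpT)), hT v hv⟩)
    (fun v hv => (hmemP v).2 (eq_primePlace_of_natCast_mem p hv)) 𝓤inf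
    (fun v hv => hUur v (fun h => hv ((hmemP v).2 h))) _
    (fun c hc v hv => by rw [(hmemP v).1 hv]; exact hc)

/-- **Over `ℚ`: Kato's `S` is finite** when `Sel_{p^∞}(E/ℚ)` is (`p` odd). [cite: Kato2004Asterisque, §14.8 (p. 238)] -/
theorem finite_kato_rat (hodd : p ≠ 2) (T : Finset (HeightOneSpectrum (𝓞 ℚ)))
    (hpT : primePlace p ∈ T) (hT : ∀ v : HeightOneSpectrum (𝓞 ℚ), v ∉ T → W.HasGoodReductionAt v)
    (𝓤inf : SelmerStructure (primaryGaloisModule W p)) [Finite (W.selmerGroupPInfty p)]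
    (hUur : ∀ v : HeightOneSpectrum (𝓞 ℚ), v ≠ primePlace p →
      𝓤inf (Sum.inr v) = unramifiedSubgroup (GaloisRep.toLocal v (primaryGaloisModule W p)) 1) :
    Finite ↥(𝓤inf.selmerGroup ⊓ selmerLocalKerPrimary W ((primePlace p).adicCompletion ℚ) p) :=
  (natCard_kato_le_selmerGroupPInfty_mul_prod_rat W p hodd T hpT hT 𝓤inf hUur).1

/-- **Over `ℚ`: `p^m · S = 0` for some `m ≥ 1`** — the hypothesis `hm` of parts 36–37. [cite: Kato2004Asterisque, §14.8 (p. 238)] -/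
theorem exists_pow_nsmul_kato_eq_zero_rat (hodd : p ≠ 2) (T : Finset (HeightOneSpectrum (𝓞 ℚ)))
    (hpT : primePlace p ∈ T) (hT : ∀ v : HeightOneSpectrum (𝓞 ℚ), v ∉ T → W.HasGoodReductionAt v)
    (𝓤inf : SelmerStructure (primaryGaloisModule W p)) [Finite (W.selmerGroupPInfty p)]
    (hUur : ∀ v : HeightOneSpectrum (𝓞 ℚ), v ≠ primePlace p →
      𝓤inf (Sum.inr v) = unramifiedSubgroup (GaloisRep.toLocal v (primaryGaloisModule W p)) 1) :
    ∃ m : ℕ, 1 ≤ m ∧ ∀ c ∈ 𝓤inf.selmerGroup ⊓ selmerLocalKerPrimary W ((primePlace p).adicCompletion ℚ) p, p ^ m • c = 0 := by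
  haveI := finite_kato_rat W p hodd T hpT hT 𝓤inf hUur
  exact Rank1Residual.X11b.AcSelmer.exists_pow_nsmul_eq_zero_of_finite _

end Rat

/-! ## §3 The local torsion exponent: `p^j` kills the `p`-power torsion of `E(K_v)` -/

section LocalTorsionExponent

variable {K : Type*} [Field K] [NumberField K] (W : WeierstrassCurve K) [W.IsElliptic] (p : ℕ) [Fact p.Prime]
  (v : HeightOneSpectrum (𝓞 K))

/-- **Some `p^j` kills every `p`-power torsion point of `E(K_v)`** (the torsion of `E(K_v)` is finite, part 33
`finite_torsion_baseChange_adicCompletion` — Silverman VII.6.3; then X11b `exists_pow_nsmul_eq_zero_of_finite_primaryComponent`) — the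
hypothesis `hj` of parts 35 and 37. [cite: SilvermanAEC2009, Prop. VII.6.3] [cite: MilneADT2006, I Lemma 3.3] -/
theorem exists_pow_nsmul_eq_zero_of_primary_localPoints :
    ∃ j : ℕ, ∀ τ : (W.baseChange (v.adicCompletion K)).toAffine.Point, (∃ a : ℕ, p ^ a • τ = 0) → p ^ j • τ = 0 := by
  haveI := finite_torsion_baseChange_adicCompletion W v
  haveI : Finite (AddCommGroup.primaryComponent (W.baseChange (v.adicCompletion K)).toAffine.Point p) :=
    Finite.of_injective
      (fun t : AddCommGroup.primaryComponent (W.baseChange (v.adicCompletion K)).toAffine.Point p =>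
        (⟨(t : (W.baseChange (v.adicCompletion K)).toAffine.Point),
          (AddCommGroup.mem_torsion _).mpr (by
            obtain ⟨n, hn⟩ := (AddCommGroup.mem_primaryComponent).mp t.2
            exact isOfFinAddOrder_iff_nsmul_eq_zero.mpr ⟨p ^ n, pow_pos (Fact.out : p.Prime).pos n, hn⟩)⟩ :
          AddCommGroup.torsion (W.baseChange (v.adicCompletion K)).toAffine.Point))
      fun a b h => by
        have h' := congrArg (fun z : ↥(AddCommGroup.torsion (W.baseChange (v.adicCompletion K)).toAffine.Point) =>
          (z : (W.baseChange (v.adicCompletion K)).toAffine.Point)) h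
        dsimp only at h'
        exact Subtype.ext h'
  obtain ⟨j, hj⟩ := Rank1Residual.X11b.exists_pow_nsmul_eq_zero_of_finite_primaryComponent
    (A := (W.baseChange (v.adicCompletion K)).toAffine.Point) (p := p)
  exact ⟨j, fun τ ⟨a, ha⟩ => hj a τ ha⟩

end LocalTorsionExponent

end Summit.BirchSwinnertonDyer.BirchSwinnertonDyer.Theorems.KatoFiniteLevelCount

end
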